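import Mathlib
import Summits.Ventures.HodgeRepro.Tier4.Target
import Summits.Ventures.HodgeRepro.Tier4.Common.TargetBall
import Summits.Ventures.HodgeRepro.Tier4.Common.TargetCalculus
import Summits.Ventures.HodgeRepro.Tier4.Common.AutForms
import Summits.Ventures.HodgeRepro.Tier4.Line3.KMDatumS
import Summits.Ventures.HodgeRepro.Tier4.Line3.KMDatumS
import Summits.Ventures.HodgeRepro.Tier4.Line3.Defs
import Summits.Ventures.HodgeRepro.Tier4.Line3.HeckeEquivarianceLemmas
import Summits.Ventures.HodgeRepro.Tier4.Line3.IntegrableMajorant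
import Summits.Ventures.HodgeRepro.Tier4.Line3.ExpansionPointwise

/-!
# Tier4/Line3/Expansion — lemma L3.2 `expansion` of LINE L3 (the orbit expansion of the pairing)

Blind re-derivation cell `pub-hodge-repro`, Tier 4 «PROVE THE STEP» (README §9–§10), seat t4-L2-p1 (gen 0), on LINE
L3 (`Tier4/Line3/Skeleton.lean` v0.14, t4-plan-3) by the lead's assignment S12208.  THE LEMMA (verbatim, v0.23
L860–L864): `theorem T4Data.expansion (D : X.ThetaData) (h1 : X.HeckeEquivariant D.Φ) (h2 : ∀ K γ, (∀ z ∈ X.domain K,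
Summable (fun w => ‖X.summand D.Φ D.cf γ w z‖)) ∧ IntegrableOn (fun z => ∑' w, ‖X.summand D.Φ D.cf γ w z‖)
(X.domain K)) : Nonempty (OrbitExpansion X.Orbit X.pairing (X.term D.Φ D.cf))` — at every level `K` and every `ℂ`-combination `γ` of Hecke quadruples of level `K`, the pairing of `P_T4` is
the ABSOLUTELY CONVERGENT sum of the orbital terms `term K γ o = ∫_{D_K} Σ_{w ∈ o} summand(γ)(w, z) dz`.

PROOF (namespace `Expansion`; `h1` = L3.1, `h2` = L3.2a, both displayed; no printed input):
* `pairing_eq_integral_tsum`: `pairing K γ = Σ_h a_h ∫_{D_K} integrand h = ∫_{D_K} Σ'_w summand(γ)(w, z)` — the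
  pointwise identity of `ExpansionPointwise` under the integral; each `integrand h` is integrable over the chosen
  domain because it is the quadruple series of `single h 1`, dominated by the majorant `h2` (`integrableOn_integrand`,
  `summand_single`), and measurable as a locally uniform limit (`continuousOn_tsum_summand`).
* `integral_tsum_summand` (FUBINI): `∫_{D_K} Σ'_w = Σ'_w ∫_{D_K}` by `MeasureTheory.integral_tsum`, whose finiteness
  hypothesis `Σ'_w ∫⁻ ‖summand w‖ₑ ≠ ∞` is Tonelli (`lintegral_tsum`) applied to the majorant `h2`
  (`tsum_lintegral_enorm_summand_ne_top`); the lines are countable (`countable_line`: a number field is countable).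
* `term_eq_tsum_fiber`: Fubini once more on each fibre of `orbitOf` — the orbital term is the series over the orbit of
  the integrals of the summands.
* `hasSum_term`: `HasSum.tsum_fiberwise` regroups the absolutely convergent series of the integrals by orbits;
  `summable_norm_term`: `‖term o‖ ≤ Σ_{w ∈ o} ∫_{D_K} ‖summand w‖`, whose fibre sums are summable over the orbits.
Nothing here says anything about the status of the Hodge conjecture for CM abelian varieties, which is NOT proved
(HC_CM is NOT proved by anyone in this repository).
-/

set_option autoImplicit false

noncomputable section

namespace Summit.Ventures.HodgeRepro.Tier4.Line3

open Summit.Ventures.HodgeRepro.Tier4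
open Matrix MeasureTheory
open scoped ComplexConjugate

namespace Expansion

open HeckeEquivariance IntegrableMajorant

variable (X : T4Data)

/-! ### 5. Integrability over the chosen domain, Fubini, and the regrouping by orbits -/

/-- Each quadruple summand is continuous on the ball. -/
theorem continuousOn_summand (D : X.ThetaData) {K : X.Level} (γ : X.Tr K) (w : X.LineTuple) :
    ContinuousOn (fun z => X.summand D.Φ D.cf γ w z) ball := by
  unfold T4Data.summand T4Data.kernel
  exact continuousOn_const.mul ((continuousOn_wedge_datum' D.Φ _ _).mul
    (Complex.continuous_conj.comp_continuousOn (continuousOn_wedge_datum' D.Φ _ _)))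

/-- The quadruple series is continuous on every compact `{nsq ≤ r}`, `r < 1` (Weierstrass M-test). -/
theorem continuousOn_tsum_summand (D : X.ThetaData) {K : X.Level} (γ : X.Tr K) {r : ℝ} (hr : r < 1) :
    ContinuousOn (fun z => ∑' w : X.LineTuple, X.summand D.Φ D.cf γ w z) {z : Fin 2 → ℂ | nsq z ≤ r} := by
  have hK : IsCompact {z : Fin 2 → ℂ | nsq z ≤ r} := isCompact_nsq_le' r hr.le
  have hKb : {z : Fin 2 → ℂ | nsq z ≤ r} ⊆ ball := fun z hz => lt_of_le_of_lt hz hr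
  obtain ⟨G, hGs, hGb⟩ := exists_majorant_summand X D K γ hK hKb
  exact continuousOn_tsum (fun w => (continuousOn_summand X D γ w).mono hKb) hGs (fun w z hz => hGb z hz w)

/-- The quadruple series is integrable over the chosen domain (dominated by the majorant of L3.2a). -/
theorem integrableOn_tsum_summand (D : X.ThetaData) (K : X.Level) (γ : X.Tr K)
    (h2 : IntegrableOn (fun z => ∑' w : X.LineTuple, ‖X.summand D.Φ D.cf γ w z‖) (X.domain K)) :
    IntegrableOn (fun z => ∑' w : X.LineTuple, X.summand D.Φ D.cf γ w z) (X.domain K) := by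
  obtain ⟨r, hr, hDr⟩ := domain_nsq_le X K
  have hDK : X.domain K ⊆ {z : Fin 2 → ℂ | nsq z ≤ r} := fun z hz => hDr z hz
  refine h2.mono' (((continuousOn_tsum_summand X D γ hr).mono hDK).aestronglyMeasurable
    (measurableSet_domain X K)) ?_
  refine (ae_restrict_mem (measurableSet_domain X K)).mono fun z hz => ?_
  exact norm_tsum_le_tsum_norm (summable_norm_summand X D γ (domain_subset_ball X K hz))

/-- The summand of the combination `single h 1` is the quadruple term of `h`. -/
theorem summand_single (D : X.ThetaData) {K : X.Level} (h : X.TrZ K) (w : X.LineTuple) (z : Fin 2 → ℂ) :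
    X.summand D.Φ D.cf (Finsupp.single h (1 : ℂ) : X.TrZ K →₀ ℂ) w z = quadTerm X D h w z := by
  unfold T4Data.summand T4Data.coefQ T4Data.kernel T4Data.rep quadTerm slotTerm
  rw [Finsupp.sum_single_index (by simp), wedge_mul_mul, wedge_mul_mul]
  simp only [map_mul]
  ring

/-- The integrand of `P_T4` at a Hecke quadruple is integrable over the chosen domain. -/
theorem integrableOn_integrand (D : X.ThetaData) (h1 : X.HeckeEquivariant D.Φ) (K : X.Level)
    (h2 : ∀ γ : X.Tr K, IntegrableOn (fun z => ∑' w : X.LineTuple, ‖X.summand D.Φ D.cf γ w z‖) (X.domain K))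
    (h : X.TrZ K) : IntegrableOn (X.integrand h.1) (X.domain K) := by
  have hint := integrableOn_tsum_summand X D K (Finsupp.single h (1 : ℂ)) (h2 _)
  refine hint.congr_fun (fun z hz => ?_) (measurableSet_domain X K)
  have hz' : z ∈ ball := domain_subset_ball X K hz
  have := sum_integrand_eq_tsum_summand X D h1 (Finsupp.single h (1 : ℂ)) hz'
  rw [Finsupp.sum_single_index (by simp), one_mul] at this
  exact this.symm

/-- **The pairing is the integral of the quadruple series over the chosen domain.** -/
theorem pairing_eq_integral_tsum (D : X.ThetaData) (h1 : X.HeckeEquivariant D.Φ) (K : X.Level)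
    (h2 : ∀ γ : X.Tr K, IntegrableOn (fun z => ∑' w : X.LineTuple, ‖X.summand D.Φ D.cf γ w z‖) (X.domain K))
    (γ : X.Tr K) :
    X.pairing K γ = ∫ z in X.domain K, ∑' w : X.LineTuple, X.summand D.Φ D.cf γ w z := by
  let γ' : X.TrZ K →₀ ℂ := γ
  calc X.pairing K γ = ∑ h ∈ γ'.support, γ' h * ∫ z in X.domain K, X.integrand h.1 z := rfl
    _ = ∑ h ∈ γ'.support, ∫ z in X.domain K, γ' h * X.integrand h.1 z := by
        refine Finset.sum_congr rfl fun h _ => ?_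
        rw [integral_const_mul]
    _ = ∫ z in X.domain K, ∑ h ∈ γ'.support, γ' h * X.integrand h.1 z :=
        (integral_finsetSum _ fun h _ => (integrableOn_integrand X D h1 K h2 h).const_mul _).symm
    _ = ∫ z in X.domain K, ∑' w : X.LineTuple, X.summand D.Φ D.cf γ w z := by
        refine setIntegral_congr_fun (measurableSet_domain X K) fun z hz => ?_
        exact sum_integrand_eq_tsum_summand X D h1 γ (domain_subset_ball X K hz)

/-- Countability of the lines (a number field is countable). -/
instance countable_line : Countable X.Line := by
  haveI : Countable X.E := Finsupp.Countable.of_moduleFinite (R := ℚ)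
  unfold T4Data.Line
  infer_instance

/-- Measurability of the summands on the chosen domain. -/
theorem aestronglyMeasurable_summand (D : X.ThetaData) (K : X.Level) (γ : X.Tr K) (w : X.LineTuple) :
    AEStronglyMeasurable (fun z => X.summand D.Φ D.cf γ w z) (volume.restrict (X.domain K)) :=
  ((continuousOn_summand X D γ w).mono (domain_subset_ball X K)).aestronglyMeasurable (measurableSet_domain X K)

/-- **Tonelli**: the total `Σ_w ∫⁻_D ‖summand w‖ₑ` is finite — it is `∫⁻_D` of the majorant of L3.2a. -/
theorem tsum_lintegral_enorm_summand_ne_top (D : X.ThetaData) (K : X.Level) (γ : X.Tr K)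
    (h2 : IntegrableOn (fun z => ∑' w : X.LineTuple, ‖X.summand D.Φ D.cf γ w z‖) (X.domain K)) :
    ∑' w : X.LineTuple, ∫⁻ z in X.domain K, ‖X.summand D.Φ D.cf γ w z‖ₑ ≠ ⊤ := by
  rw [← lintegral_tsum fun w => (aestronglyMeasurable_summand X D K γ w).enorm]
  have hfin := h2.hasFiniteIntegral
  unfold HasFiniteIntegral at hfin
  refine ne_of_lt (lt_of_eq_of_lt ?_ hfin)
  refine setLIntegral_congr_fun (measurableSet_domain X K) fun z hz => ?_
  rw [Real.enorm_of_nonneg (tsum_nonneg fun w => norm_nonneg _),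
    ENNReal.ofReal_tsum_of_nonneg (fun w => norm_nonneg _) (summable_norm_summand X D γ (domain_subset_ball X K hz))]
  exact tsum_congr fun w => (ofReal_norm _).symm

/-- **Fubini**: the integral of the quadruple series over the chosen domain is the series of the integrals. -/
theorem integral_tsum_summand (D : X.ThetaData) (K : X.Level) (γ : X.Tr K)
    (h2 : IntegrableOn (fun z => ∑' w : X.LineTuple, ‖X.summand D.Φ D.cf γ w z‖) (X.domain K)) :
    ∫ z in X.domain K, ∑' w : X.LineTuple, X.summand D.Φ D.cf γ w z =
      ∑' w : X.LineTuple, ∫ z in X.domain K, X.summand D.Φ D.cf γ w z :=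
  integral_tsum (fun w => aestronglyMeasurable_summand X D K γ w) (tsum_lintegral_enorm_summand_ne_top X D K γ h2)

/-- The integrals of the norms of the summands are summable (Tonelli). -/
theorem summable_integral_norm_summand (D : X.ThetaData) (K : X.Level) (γ : X.Tr K)
    (h2 : IntegrableOn (fun z => ∑' w : X.LineTuple, ‖X.summand D.Φ D.cf γ w z‖) (X.domain K)) :
    Summable (fun w : X.LineTuple => ∫ z in X.domain K, ‖X.summand D.Φ D.cf γ w z‖) := by
  have := ENNReal.summable_toReal (tsum_lintegral_enorm_summand_ne_top X D K γ h2)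
  refine this.congr fun w => ?_
  rw [integral_norm_eq_lintegral_enorm (aestronglyMeasurable_summand X D K γ w)]

/-! ### 6. The regrouping by orbits -/

/-- **Fubini on a fibre**: the orbital term is the series over the orbit of the integrals of the summands. -/
theorem term_eq_tsum_fiber (D : X.ThetaData) (K : X.Level) (γ : X.Tr K)
    (h2 : IntegrableOn (fun z => ∑' w : X.LineTuple, ‖X.summand D.Φ D.cf γ w z‖) (X.domain K)) (o : X.Orbit) :
    X.term D.Φ D.cf K γ o =
      ∑' w : {w : X.LineTuple // X.orbitOf w = o}, ∫ z in X.domain K, X.summand D.Φ D.cf γ w.1 z := by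
  unfold T4Data.term
  refine integral_tsum (fun w => aestronglyMeasurable_summand X D K γ w.1) ?_
  refine ne_top_of_le_ne_top (tsum_lintegral_enorm_summand_ne_top X D K γ h2) ?_
  exact ENNReal.tsum_comp_le_tsum_of_injective Subtype.val_injective _

/-- The integrals of the summands are summable (majorised by the integrals of the norms). -/
theorem summable_integral_summand (D : X.ThetaData) (K : X.Level) (γ : X.Tr K)
    (h2 : IntegrableOn (fun z => ∑' w : X.LineTuple, ‖X.summand D.Φ D.cf γ w z‖) (X.domain K)) :
    Summable (fun w : X.LineTuple => ∫ z in X.domain K, X.summand D.Φ D.cf γ w z) :=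
  Summable.of_norm_bounded (summable_integral_norm_summand X D K γ h2)
    (fun _ => norm_integral_le_integral_norm _)

/-- **THE ORBIT EXPANSION OF THE PAIRING**: `pairing K γ = Σ_orbits term K γ o`, as a `HasSum`. -/
theorem hasSum_term (D : X.ThetaData) (h1 : X.HeckeEquivariant D.Φ) (K : X.Level)
    (h2 : ∀ γ : X.Tr K, IntegrableOn (fun z => ∑' w : X.LineTuple, ‖X.summand D.Φ D.cf γ w z‖) (X.domain K))
    (γ : X.Tr K) : HasSum (fun o => X.term D.Φ D.cf K γ o) (X.pairing K γ) := by
  have hS := (summable_integral_summand X D K γ (h2 γ)).hasSum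
  rw [← integral_tsum_summand X D K γ (h2 γ), ← pairing_eq_integral_tsum X D h1 K h2 γ] at hS
  have hF := hS.tsum_fiberwise X.orbitOf
  have heq : (fun o => X.term D.Φ D.cf K γ o) =
      fun c => ∑' b : X.orbitOf ⁻¹' {c}, ∫ z in X.domain K, X.summand D.Φ D.cf γ b z := by
    funext o
    rw [term_eq_tsum_fiber X D K γ (h2 γ) o]
    rfl
  rw [heq]
  exact hF

/-- **Absolute convergence of the orbit expansion**: the orbital terms are absolutely summable. -/
theorem summable_norm_term (D : X.ThetaData) (K : X.Level) (γ : X.Tr K)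
    (h2 : IntegrableOn (fun z => ∑' w : X.LineTuple, ‖X.summand D.Φ D.cf γ w z‖) (X.domain K)) :
    Summable (fun o => ‖X.term D.Φ D.cf K γ o‖) := by
  have hbs : Summable (fun w : X.LineTuple => ∫ z in X.domain K, ‖X.summand D.Φ D.cf γ w z‖) :=
    summable_integral_norm_summand X D K γ h2
  have hfib : Summable (fun o : X.Orbit =>
      ∑' w : X.orbitOf ⁻¹' {o}, ∫ z in X.domain K, ‖X.summand D.Φ D.cf γ w z‖) :=
    (hbs.hasSum.tsum_fiberwise X.orbitOf).summable
  refine Summable.of_nonneg_of_le (fun _ => norm_nonneg _) (fun o => ?_) hfib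
  rw [term_eq_tsum_fiber X D K γ h2 o]
  have hsub : Summable (fun w : {w : X.LineTuple // X.orbitOf w = o} =>
      ∫ z in X.domain K, ‖X.summand D.Φ D.cf γ w.1 z‖) := hbs.subtype _
  have hn : Summable (fun w : {w : X.LineTuple // X.orbitOf w = o} =>
      ‖∫ z in X.domain K, X.summand D.Φ D.cf γ w.1 z‖) :=
    Summable.of_nonneg_of_le (fun _ => norm_nonneg _) (fun w => norm_integral_le_integral_norm _) hsub
  calc ‖∑' w : {w : X.LineTuple // X.orbitOf w = o}, ∫ z in X.domain K, X.summand D.Φ D.cf γ w.1 z‖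
      ≤ ∑' w : {w : X.LineTuple // X.orbitOf w = o}, ‖∫ z in X.domain K, X.summand D.Φ D.cf γ w.1 z‖ :=
        norm_tsum_le_tsum_norm hn
    _ ≤ ∑' w : {w : X.LineTuple // X.orbitOf w = o}, ∫ z in X.domain K, ‖X.summand D.Φ D.cf γ w.1 z‖ :=
        hn.tsum_le_tsum (fun w => norm_integral_le_integral_norm _) hsub
    _ = ∑' w : X.orbitOf ⁻¹' {o}, ∫ z in X.domain K, ‖X.summand D.Φ D.cf γ w z‖ := rfl

end Expansion

namespace T4Data

variable (X : T4Data)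

/-- **L3.2 THE ORBIT EXPANSION (prover item; consumes L3.1 = `h1` and L3.2a = `h2`).** At every level and for every
`ℂ`-combination of Hecke quadruples the pairing is the absolutely convergent sum of the orbital terms: `h1` for the
four slots, bilinearity of `wedge` and `jacDet` (typer-2), the product of four absolutely convergent series, Fubini on
the fundamental domain (`h2`), and the partition of `LineTuple` into the fibres of `orbitOf` (`tsum_sigma`).
Statement verbatim from `Tier4/Line3/Skeleton.lean` v0.23 L860–L864 (v0.15 added the pointwise-summability conjunct
to `h2`, which this proof does not even need: the summability is re-derived from `ThetaData.summable`). -/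
theorem expansion (D : X.ThetaData) (h1 : X.HeckeEquivariant D.Φ)
    (h2 : ∀ (K : X.Level) (γ : X.Tr K),
      (∀ z ∈ X.domain K, Summable (fun w : X.LineTuple => ‖X.summand D.Φ D.cf γ w z‖)) ∧
        IntegrableOn (fun z => ∑' w : X.LineTuple, ‖X.summand D.Φ D.cf γ w z‖) (X.domain K)) :
    Nonempty (OrbitExpansion X.Orbit X.pairing (X.term D.Φ D.cf)) :=
  ⟨{ summable_norm := fun K γ => Expansion.summable_norm_term X D K γ (h2 K γ).2
     expansion := fun K γ => (Expansion.hasSum_term X D h1 K (fun γ => (h2 K γ).2) γ).tsum_eq.symm }⟩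

end T4Data

end Summit.Ventures.HodgeRepro.Tier4.Line3

end
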